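import Summits.NavierStokesRegularity.NavierStokesRegularity.Theorems.GaldiLiouvilleGateRecordZoomAncientOfKernel
import HarnessLib

/-!
# Route `GaldiLiouvilleGate`, crux `RecordZoomAncient` (stmt-NavierStokesRegularity-0894),
  line `registered` (r5) — the registered kernel IS "no faint blow-up": `Kernel(r5) ↔ FCV`

Notation: `u` a classical Navier–Stokes solution on `ℝ³ × [0, T)`, Leray–Hopf from the rapidly
decaying `u 0`, with no smooth extension past `T`; `E(s) = ∫⁻ |∇u(s)|²`; a level `L > 0`
DOMINATES at `t` if `E ≤ L` on `[0, t]`.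

* FCV ("frequent critical velocity" = NO FAINT BLOW-UP, clean form): for every such blow-up there
  is `θ > 0` such that for every `t' < T` some `t ∈ [t', T)`, `x` and dominating level `L` at `t`
  have `‖u(t, x)‖ ≥ θ L/ν`.
* Kernel(r5) (the registered stub `stub_thinSlowKernel` of `Cruxes/RecordZoomAncient/Lines/birth.lean`,
  verbatim): such a blow-up cannot be simultaneously TYPE-II IN ENSTROPHY, EVENTUALLY SLOWLY
  DOUBLING AT EVERY SCALE, VANISHING AT THE CRITICAL SCALE and FAINT (`∀ θ > 0`, eventually
  `‖u(t, x)‖ < θ L/ν` for all `x` and all dominating `L`).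

`noFaintBlowupKernel_of_frequentCriticalVelocity : FCV → Kernel` is propositional (FCV negates
faintness). `frequentCriticalVelocity_of_noFaintBlowupKernel : Kernel → FCV` is the content: if
FCV failed for a blow-up, that blow-up is faint; each of the other three structural hypotheses
then holds too, because its failure produces velocity-concentrated zooms by a LANDED branch of the
line (`stub_typeIBranch` with Leray's rate `leray_blowup_rate_top_holds`; `stub_fastBranch`;
`stub_enstrophyConcentrationBranch` with the `C^{1,κ}` bounds `stub_zoomC1kappa stub_oseenC1kappa`
and `stub_zoomBound`), and velocity-concentrated zooms give critical velocity arbitrarily close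
to `T` (`exists_criticalVelocity_of_concentratedZooms`: the zoom centres carry
`‖u‖ ≥ θ L_n/ν → ∞`, so by the boundedness of `u` on every `[0, T''] × ℝ³`, `T'' < T` — the Tao
representation `stub_taoRep` — their times accumulate at `T`); so the kernel yields `False`.
Consequently the open content of the crux is exactly FCV, a single clean statement a planner can
file; `recordZoomAncient_of_frequentCriticalVelocity` (file
`GaldiLiouvilleGateRecordZoomAncientOfKernel.lean`) closes the crux from it.
-/

noncomputable section

open Set MeasureTheory Filter Topology Function
open scoped ENNReal NNReal
open Literature.Analysis.FluidPDE

namespace Summit.NavierStokesRegularity.NavierStokesRegularity.Theorems.RecordZoomAncient.Birth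

-- the problem-side namespace `Summit.NavierStokesRegularity.NavierStokesRegularity.…` (summit =
-- problem for this single-problem summit) duplicates `NavierStokesRegularity` by design
set_option linter.dupNamespace false

/-- **Velocity-concentrated zooms give critical velocity arbitrarily close to `T`.** If `u` is
bounded on every `[0, T''] × ℝ³`, `T'' < T` (here: Tao-class on sub-slabs), and base times
`tc n ∈ (0, T)`, centres `xc n`, dominating levels `L n > 0` with `tc n (L n)² → ∞` carry
`‖(ν/L n) u(t_n, xc n)‖ ≥ θ > 0` at `t_n = tc n + ν³ s₀/(L n)²` (`s₀ < 0`), then for every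
`t' < T` some `t_n ≥ t'` qualifies: otherwise, for `n` large (`t_n ≥ 0`), `θ L n/ν ≤ ‖u(t_n, xc n)‖ ≤ B`
bounds `L n`, hence `tc n (L n)² < T (B+1)²ν²/θ²`, contradicting `tc n (L n)² → ∞`. -/
theorem exists_criticalVelocity_of_concentratedZooms
    {ν T : ℝ} (hν : 0 < ν) (hT : 0 < T)
    {u : ℝ → EuclideanSpace ℝ (Fin 3) → EuclideanSpace ℝ (Fin 3)}
    (hrep : ∀ T' ∈ Set.Ioo 0 T, ∃ P : ℝ → EuclideanSpace ℝ (Fin 3) → ℝ, IsTaoSolutionOn T' ν (u 0) u P)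
    {tc : ℕ → ℝ} {xc : ℕ → EuclideanSpace ℝ (Fin 3)} {L : ℕ → ℝ} {s₀ θ : ℝ}
    (hs₀ : s₀ < 0) (hθ : 0 < θ) (htc : ∀ n, 0 < tc n ∧ tc n < T) (hL : ∀ n, 0 < L n)
    (hdom : ∀ n, ∀ t ∈ Set.Icc 0 (tc n),
      ∫⁻ x, ENNReal.ofReal (frobeniusNormSq (fderiv ℝ (u t) x)) ≤ ENNReal.ofReal (L n))
    (hpast : Tendsto (fun n => tc n * L n ^ 2) atTop atTop)
    (hconc : ∀ n, θ ≤ ‖(ν / L n) • u (tc n + ν ^ 3 / L n ^ 2 * s₀) (xc n)‖) :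
    ∀ t' ∈ Set.Ico 0 T, ∃ t ∈ Set.Ico t' T, ∃ x : EuclideanSpace ℝ (Fin 3), ∃ L' : ℝ, 0 < L' ∧
      (∀ s ∈ Set.Icc 0 t,
        (∫⁻ x, ENNReal.ofReal (frobeniusNormSq (fderiv ℝ (u s) x))) ≤ ENNReal.ofReal L') ∧
      θ * L' / ν ≤ ‖u t x‖ := by
  intro t' ht'
  -- a velocity bound on `[0, T''] × ℝ³`, `T'' = (t' + T)/2`
  have hT'' : (t' + T) / 2 ∈ Set.Ioo 0 T := ⟨by linarith [ht'.1], by linarith [ht'.2]⟩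
  obtain ⟨P, hP⟩ := hrep _ hT''
  obtain ⟨B, hB0, hB⟩ := hP.exists_bound_velocity
  -- a large index
  set Λ : ℝ := (B + 1) * ν / θ with hΛ_def
  have hΛ : 0 < Λ := by positivity
  obtain ⟨n, hn⟩ := (hpast.eventually_gt_atTop (max (-s₀ * ν ^ 3) (T * Λ ^ 2))).exists
  have hn1 : -s₀ * ν ^ 3 < tc n * L n ^ 2 := (le_max_left _ _).trans_lt hn
  have hn2 : T * Λ ^ 2 < tc n * L n ^ 2 := (le_max_right _ _).trans_lt hn
  have hLn := hL n
  have htcn := htc n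
  set tn : ℝ := tc n + ν ^ 3 / L n ^ 2 * s₀ with htn_def
  have hL2 : 0 < L n ^ 2 := by positivity
  have htn0 : 0 ≤ tn := by
    have h1 : -s₀ * ν ^ 3 / L n ^ 2 ≤ tc n := by
      rw [div_le_iff₀ hL2]
      exact hn1.le
    have h2 : ν ^ 3 / L n ^ 2 * s₀ = -(-s₀ * ν ^ 3 / L n ^ 2) := by ring
    rw [htn_def, h2]
    linarith
  have htn_lt : tn < tc n := by
    have h1 : ν ^ 3 / L n ^ 2 * s₀ < 0 := mul_neg_of_pos_of_neg (by positivity) hs₀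
    rw [htn_def]
    linarith
  -- the velocity at `(tn, xc n)`
  have hvel : θ * L n / ν ≤ ‖u tn (xc n)‖ := by
    have h := hconc n
    rw [norm_smul, Real.norm_of_nonneg (by positivity : (0 : ℝ) ≤ ν / L n)] at h
    have h' : θ * (L n / ν) ≤ ν / L n * ‖u tn (xc n)‖ * (L n / ν) :=
      mul_le_mul_of_nonneg_right h (by positivity)
    have heq : ν / L n * ‖u tn (xc n)‖ * (L n / ν) = ‖u tn (xc n)‖ := by
      field_simp
    calc θ * L n / ν = θ * (L n / ν) := by ring
      _ ≤ ν / L n * ‖u tn (xc n)‖ * (L n / ν) := h'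
      _ = ‖u tn (xc n)‖ := heq
  by_cases hcase : t' ≤ tn
  · exact ⟨tn, ⟨hcase, htn_lt.trans htcn.2⟩, xc n, L n, hLn,
      fun s hs => hdom n s ⟨hs.1, hs.2.trans htn_lt.le⟩, hvel⟩
  · -- `tn < t'`: the velocity bound caps `L n`, contradicting the size of `tc n (L n)²`
    exfalso
    push Not at hcase
    have hB' : ‖u tn (xc n)‖ ≤ B := hB tn ⟨htn0, by linarith [ht'.2]⟩ (xc n)
    have hLle : L n ≤ B * ν / θ := by
      rw [le_div_iff₀ hθ]
      have h := (div_le_iff₀ hν).1 (hvel.trans hB')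
      linarith [h]
    have hLlt : L n < Λ := by
      calc L n ≤ B * ν / θ := hLle
        _ < (B + 1) * ν / θ := by
          apply div_lt_div_of_pos_right _ hθ
          nlinarith
    have hlt : tc n * L n ^ 2 < T * Λ ^ 2 := by
      have h1 : L n ^ 2 < Λ ^ 2 := by
        exact pow_lt_pow_left₀ hLlt hLn.le two_ne_zero
      calc tc n * L n ^ 2 < T * L n ^ 2 := by
            exact mul_lt_mul_of_pos_right htcn.2 hL2
        _ ≤ T * Λ ^ 2 := by
            exact mul_le_mul_of_nonneg_left h1.le hT.le
    exact absurd hn2 (not_lt.2 hlt.le)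

/-- **FCV → Kernel(r5)** (propositional): frequent critical velocity with ratio `θ` contradicts
the kernel's fourth structural hypothesis (faintness) at that `θ`. -/
theorem noFaintBlowupKernel_of_frequentCriticalVelocity :
    (∀ (ν T : ℝ), 0 < ν → 0 < T →
      ∀ (u : ℝ → EuclideanSpace ℝ (Fin 3) → EuclideanSpace ℝ (Fin 3)) (p : ℝ → EuclideanSpace ℝ (Fin 3) → ℝ),
        IsClassicalNSSolutionOn (Set.Ico 0 T) ν 0 u p → IsLerayHopfOn T ν 0 (u 0) u →
        HasRapidSpatialDecay (u 0) → ¬ HasSmoothExtensionPast ν 0 u T →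
        ∃ θ : ℝ, 0 < θ ∧ ∀ t' ∈ Set.Ico 0 T, ∃ t ∈ Set.Ico t' T,
          ∃ x : EuclideanSpace ℝ (Fin 3), ∃ L : ℝ, 0 < L ∧
            (∀ s ∈ Set.Icc 0 t,
              (∫⁻ x, ENNReal.ofReal (frobeniusNormSq (fderiv ℝ (u s) x))) ≤ ENNReal.ofReal L) ∧
            θ * L / ν ≤ ‖u t x‖) →
    (∀ (ν T : ℝ), 0 < ν → 0 < T →
      ∀ (u : ℝ → EuclideanSpace ℝ (Fin 3) → EuclideanSpace ℝ (Fin 3)) (p : ℝ → EuclideanSpace ℝ (Fin 3) → ℝ),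
        IsClassicalNSSolutionOn (Set.Ico 0 T) ν 0 u p → IsLerayHopfOn T ν 0 (u 0) u →
        HasRapidSpatialDecay (u 0) → ¬ HasSmoothExtensionPast ν 0 u T →
        (∀ C : ℝ, 0 < C → ∃ t' ∈ Set.Ico 0 T, ∀ t ∈ Set.Ico t' T, ∃ s ∈ Set.Icc 0 t,
            ENNReal.ofReal (C * (ν * Real.sqrt ν) / Real.sqrt (T - t)) <
              ∫⁻ x, ENNReal.ofReal (frobeniusNormSq (fderiv ℝ (u s) x))) →
        (∀ K : ℝ, 0 < K → ∃ t' ∈ Set.Ico 0 T, ∀ t₁ ∈ Set.Ico t' T, ∀ t₂ ∈ Set.Ioo t₁ T, ∀ L : ℝ, 0 < L →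
            (∀ s ∈ Set.Icc 0 t₂,
              (∫⁻ x, ENNReal.ofReal (frobeniusNormSq (fderiv ℝ (u s) x))) ≤ ENNReal.ofReal (2 * L)) →
            (∫⁻ x, ENNReal.ofReal (frobeniusNormSq (fderiv ℝ (u t₁) x))) ≤ ENNReal.ofReal L →
            ENNReal.ofReal (2 * L) ≤ (∫⁻ x, ENNReal.ofReal (frobeniusNormSq (fderiv ℝ (u t₂) x))) →
            K * ν ^ 3 / L ^ 2 ≤ t₂ - t₁) →
        (∀ R ε : ℝ, 0 < R → 0 < ε → ∃ t' ∈ Set.Ico 0 T, ∀ t ∈ Set.Ico t' T,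
            ∀ x : EuclideanSpace ℝ (Fin 3), ∀ L : ℝ, 0 < L →
            (∀ s ∈ Set.Icc 0 t,
              (∫⁻ x, ENNReal.ofReal (frobeniusNormSq (fderiv ℝ (u s) x))) ≤ ENNReal.ofReal L) →
            3 * ν ^ 3 / L ^ 2 ≤ t →
            (∫⁻ y in Metric.ball x (R * ν ^ 2 / L), ENNReal.ofReal (frobeniusNormSq (fderiv ℝ (u t) y))) <
              ENNReal.ofReal (ε * L)) →
        (∀ θ : ℝ, 0 < θ → ∃ t' ∈ Set.Ico 0 T, ∀ t ∈ Set.Ico t' T,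
            ∀ x : EuclideanSpace ℝ (Fin 3), ∀ L : ℝ, 0 < L →
            (∀ s ∈ Set.Icc 0 t,
              (∫⁻ x, ENNReal.ofReal (frobeniusNormSq (fderiv ℝ (u s) x))) ≤ ENNReal.ofReal L) →
            ‖u t x‖ < θ * L / ν) →
        False) := by
  intro hFCV ν T hν hT u p hcl hLH hdec hnext _h1 _h2 _h3 h4
  obtain ⟨θ, hθ, hV⟩ := hFCV ν T hν hT u p hcl hLH hdec hnext
  obtain ⟨t', ht', h4'⟩ := h4 θ hθ
  obtain ⟨t, ht, x, L, hL, hdom, hge⟩ := hV t' ht'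
  exact absurd (h4' t ht x L hL hdom) (not_lt.2 hge)

/-- **Kernel(r5) → FCV** (the content). Fix a blow-up as in the crux and suppose FCV fails for
it: then it is FAINT (hypothesis 4 of the kernel, by pushing the negation). It is also TYPE-II IN
ENSTROPHY: otherwise the enstrophy is Type-I bounded along a sequence and `stub_typeIBranch` (fed
by Leray's `L^∞` rate `leray_blowup_rate_top_holds` and the persistence bound
`stub_enstrophyPersistence`) yields velocity-concentrated zooms, hence critical velocity
arbitrarily close to `T` (`exists_criticalVelocity_of_concentratedZooms`), i.e. FCV after all.
Likewise EVENTUALLY SLOWLY DOUBLING (else `stub_fastBranch`) and VANISHING AT THE CRITICAL SCALE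
(else `stub_enstrophyConcentrationBranch`, with the uniform `C^{1,κ}` bounds of
`stub_zoomC1kappa stub_oseenC1kappa` on top of `stub_zoomBound`). The kernel then gives `False`. -/
theorem frequentCriticalVelocity_of_noFaintBlowupKernel :
    (∀ (ν T : ℝ), 0 < ν → 0 < T →
      ∀ (u : ℝ → EuclideanSpace ℝ (Fin 3) → EuclideanSpace ℝ (Fin 3)) (p : ℝ → EuclideanSpace ℝ (Fin 3) → ℝ),
        IsClassicalNSSolutionOn (Set.Ico 0 T) ν 0 u p → IsLerayHopfOn T ν 0 (u 0) u →
        HasRapidSpatialDecay (u 0) → ¬ HasSmoothExtensionPast ν 0 u T →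
        (∀ C : ℝ, 0 < C → ∃ t' ∈ Set.Ico 0 T, ∀ t ∈ Set.Ico t' T, ∃ s ∈ Set.Icc 0 t,
            ENNReal.ofReal (C * (ν * Real.sqrt ν) / Real.sqrt (T - t)) <
              ∫⁻ x, ENNReal.ofReal (frobeniusNormSq (fderiv ℝ (u s) x))) →
        (∀ K : ℝ, 0 < K → ∃ t' ∈ Set.Ico 0 T, ∀ t₁ ∈ Set.Ico t' T, ∀ t₂ ∈ Set.Ioo t₁ T, ∀ L : ℝ, 0 < L →
            (∀ s ∈ Set.Icc 0 t₂,
              (∫⁻ x, ENNReal.ofReal (frobeniusNormSq (fderiv ℝ (u s) x))) ≤ ENNReal.ofReal (2 * L)) →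
            (∫⁻ x, ENNReal.ofReal (frobeniusNormSq (fderiv ℝ (u t₁) x))) ≤ ENNReal.ofReal L →
            ENNReal.ofReal (2 * L) ≤ (∫⁻ x, ENNReal.ofReal (frobeniusNormSq (fderiv ℝ (u t₂) x))) →
            K * ν ^ 3 / L ^ 2 ≤ t₂ - t₁) →
        (∀ R ε : ℝ, 0 < R → 0 < ε → ∃ t' ∈ Set.Ico 0 T, ∀ t ∈ Set.Ico t' T,
            ∀ x : EuclideanSpace ℝ (Fin 3), ∀ L : ℝ, 0 < L →
            (∀ s ∈ Set.Icc 0 t,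
              (∫⁻ x, ENNReal.ofReal (frobeniusNormSq (fderiv ℝ (u s) x))) ≤ ENNReal.ofReal L) →
            3 * ν ^ 3 / L ^ 2 ≤ t →
            (∫⁻ y in Metric.ball x (R * ν ^ 2 / L), ENNReal.ofReal (frobeniusNormSq (fderiv ℝ (u t) y))) <
              ENNReal.ofReal (ε * L)) →
        (∀ θ : ℝ, 0 < θ → ∃ t' ∈ Set.Ico 0 T, ∀ t ∈ Set.Ico t' T,
            ∀ x : EuclideanSpace ℝ (Fin 3), ∀ L : ℝ, 0 < L →
            (∀ s ∈ Set.Icc 0 t,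
              (∫⁻ x, ENNReal.ofReal (frobeniusNormSq (fderiv ℝ (u s) x))) ≤ ENNReal.ofReal L) →
            ‖u t x‖ < θ * L / ν) →
        False) →
    (∀ (ν T : ℝ), 0 < ν → 0 < T →
      ∀ (u : ℝ → EuclideanSpace ℝ (Fin 3) → EuclideanSpace ℝ (Fin 3)) (p : ℝ → EuclideanSpace ℝ (Fin 3) → ℝ),
        IsClassicalNSSolutionOn (Set.Ico 0 T) ν 0 u p → IsLerayHopfOn T ν 0 (u 0) u →
        HasRapidSpatialDecay (u 0) → ¬ HasSmoothExtensionPast ν 0 u T →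
        ∃ θ : ℝ, 0 < θ ∧ ∀ t' ∈ Set.Ico 0 T, ∃ t ∈ Set.Ico t' T,
          ∃ x : EuclideanSpace ℝ (Fin 3), ∃ L : ℝ, 0 < L ∧
            (∀ s ∈ Set.Icc 0 t,
              (∫⁻ x, ENNReal.ofReal (frobeniusNormSq (fderiv ℝ (u s) x))) ≤ ENNReal.ofReal L) ∧
            θ * L / ν ≤ ‖u t x‖) := by
  intro hKernel ν T hν hT u p hcl hLH hdec hnext
  -- (0) the representation and the persistence constants
  have hrep : ∀ T' ∈ Set.Ioo 0 T, ∃ P : ℝ → EuclideanSpace ℝ (Fin 3) → ℝ, IsTaoSolutionOn T' ν (u 0) u P :=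
    stub_taoRep ν T hν hT u p hcl hLH hdec
  obtain ⟨cP, K, hcP, hK, hpers⟩ := stub_enstrophyPersistence
  have hpers' := hpers ν T hν hT u p hcl hrep
  -- Leray's `L^∞` blow-up rate, strip-boundedness from the representation
  obtain ⟨cL, hcL, hLer⟩ := leray_blowup_rate_top_holds
  have hstrip : ∀ T' ∈ Set.Ioo 0 T,
      eLpNorm (uncurry u) ∞ (volume.restrict (Set.Icc 0 T' ×ˢ univ)) < ∞ := by
    intro T' hT'
    obtain ⟨P, hP⟩ := hrep T' hT'
    obtain ⟨B, -, hB⟩ := hP.exists_bound_velocity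
    rw [eLpNorm_exponent_top]
    refine eLpNormEssSup_lt_top_of_ae_bound (C := B) ?_
    filter_upwards [ae_restrict_mem (measurableSet_Icc.prod MeasurableSet.univ)] with w hw
    obtain ⟨t, x⟩ := w
    exact hB t hw.1 x
  have hrate : ∀ t ∈ Set.Ico 0 T, ∃ x, cL / 2 * Real.sqrt ν / Real.sqrt (T - t) ≤ ‖u t x‖ := by
    intro t ht
    have h := hLer ν T hν hT u p ⟨hcl, hnext⟩ hLH hstrip t ht
    have ha : 0 < cL * Real.sqrt ν / Real.sqrt (T - t) := by
      have h1 : 0 < Real.sqrt ν := Real.sqrt_pos.2 hν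
      have h2 : 0 < Real.sqrt (T - t) := Real.sqrt_pos.2 (sub_pos.2 ht.2)
      positivity
    obtain ⟨x, hx⟩ := exists_half_le_norm_of_ofReal_le_eLpNorm_top ha h
    refine ⟨x, ?_⟩
    have heq : cL / 2 * Real.sqrt ν / Real.sqrt (T - t) = cL * Real.sqrt ν / Real.sqrt (T - t) / 2 := by ring
    rw [heq]
    exact hx
  -- the universal velocity bound and the `C^{1,κ}` constants
  obtain ⟨C, hC⟩ := stub_zoomBound
  obtain ⟨C₁, H, κ, hκ, hC1k⟩ := stub_zoomC1kappa stub_oseenC1kappa C hC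
  have hC1k' := hC1k ν T hν hT u p hcl hLH hdec hrep
  -- zooms give the conclusion; so suppose it fails
  by_contra hnot
  push Not at hnot
  have hzooms : ∀ (tc : ℕ → ℝ) (xc : ℕ → EuclideanSpace ℝ (Fin 3)) (L : ℕ → ℝ) (s₀ θ : ℝ),
      s₀ < 0 → 0 < θ → (∀ n, 0 < tc n ∧ tc n < T) → (∀ n, 0 < L n) →
      (∀ n, ∀ t ∈ Set.Icc 0 (tc n),
        ∫⁻ x, ENNReal.ofReal (frobeniusNormSq (fderiv ℝ (u t) x)) ≤ ENNReal.ofReal (L n)) →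
      Tendsto (fun n => tc n * L n ^ 2) atTop atTop →
      (∀ n, θ ≤ ‖(ν / L n) • u (tc n + ν ^ 3 / L n ^ 2 * s₀) (xc n)‖) → False := by
    intro tc xc L s₀ θ hs₀ hθ htc hL hdom hpast hconc
    obtain ⟨t', ht', hlt⟩ := hnot θ hθ
    obtain ⟨t, ht, x, L', hL', hdom', hge⟩ :=
      exists_criticalVelocity_of_concentratedZooms hν hT hrep hs₀ hθ htc hL hdom hpast hconc t' ht'
    exact absurd (hlt t ht x L' hL' hdom') (not_lt.2 hge)
  -- (1) Type-II enstrophy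
  have h1 : ∀ C : ℝ, 0 < C → ∃ t' ∈ Set.Ico 0 T, ∀ t ∈ Set.Ico t' T, ∃ s ∈ Set.Icc 0 t,
      ENNReal.ofReal (C * (ν * Real.sqrt ν) / Real.sqrt (T - t)) <
        ∫⁻ x, ENNReal.ofReal (frobeniusNormSq (fderiv ℝ (u s) x)) := by
    by_contra hI
    push Not at hI
    obtain ⟨C', hC', hI⟩ := hI
    obtain ⟨tc, xc, L, s₀, θ, hs₀, hθ, htc, hL, hdom, hpast, hconc⟩ :=
      stub_typeIBranch ν T hν hT u p hcl (cL / 2) (by positivity) hrate cP K hcP hK hpers' C' hC' hI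
    exact hzooms tc xc L s₀ θ hs₀ hθ htc hL hdom hpast hconc
  -- (2) eventually slow doubling at every scale
  have h2 : ∀ K : ℝ, 0 < K → ∃ t' ∈ Set.Ico 0 T, ∀ t₁ ∈ Set.Ico t' T, ∀ t₂ ∈ Set.Ioo t₁ T, ∀ L : ℝ, 0 < L →
      (∀ s ∈ Set.Icc 0 t₂,
        (∫⁻ x, ENNReal.ofReal (frobeniusNormSq (fderiv ℝ (u s) x))) ≤ ENNReal.ofReal (2 * L)) →
      (∫⁻ x, ENNReal.ofReal (frobeniusNormSq (fderiv ℝ (u t₁) x))) ≤ ENNReal.ofReal L →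
      ENNReal.ofReal (2 * L) ≤ (∫⁻ x, ENNReal.ofReal (frobeniusNormSq (fderiv ℝ (u t₂) x))) →
      K * ν ^ 3 / L ^ 2 ≤ t₂ - t₁ := by
    by_contra hFD
    push Not at hFD
    obtain ⟨K₀, hK₀, hFD⟩ := hFD
    obtain ⟨tc, xc, L, s₀, θ, hs₀, hθ, htc, hL, hdom, hpast, hconc⟩ :=
      stub_fastBranch ν T hν hT u p hcl hLH hrep hnext cP K hcP hK hpers' K₀ hK₀ hFD
    exact hzooms tc xc L s₀ θ hs₀ hθ htc hL hdom hpast hconc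
  -- (3) vanishing at the critical scale
  have h3 : ∀ R ε : ℝ, 0 < R → 0 < ε → ∃ t' ∈ Set.Ico 0 T, ∀ t ∈ Set.Ico t' T,
      ∀ x : EuclideanSpace ℝ (Fin 3), ∀ L : ℝ, 0 < L →
      (∀ s ∈ Set.Icc 0 t,
        (∫⁻ x, ENNReal.ofReal (frobeniusNormSq (fderiv ℝ (u s) x))) ≤ ENNReal.ofReal L) →
      3 * ν ^ 3 / L ^ 2 ≤ t →
      (∫⁻ y in Metric.ball x (R * ν ^ 2 / L), ENNReal.ofReal (frobeniusNormSq (fderiv ℝ (u t) y))) <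
        ENNReal.ofReal (ε * L) := by
    by_contra hEC
    push Not at hEC
    obtain ⟨R, ε, hR, hε, hEC⟩ := hEC
    obtain ⟨tc, xc, L, s₀, θ, hs₀, hθ, htc, hL, hdom, hpast, hconc⟩ :=
      stub_enstrophyConcentrationBranch ν T hν hT u p hcl hLH hrep hnext cP K hcP hK hpers'
        C₁ H κ hκ hC1k' R ε hR hε hEC
    exact hzooms tc xc L s₀ θ hs₀ hθ htc hL hdom hpast hconc
  -- (4) faintness is `hnot`; the kernel closes
  exact hKernel ν T hν hT u p hcl hLH hdec hnext h1 h2 h3 hnot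

end Summit.NavierStokesRegularity.NavierStokesRegularity.Theorems.RecordZoomAncient.Birth

end
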